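import Literature.Computability.QuantumComplexity.CompilerCodeFP
import Literature.Computability.QuantumComplexity.CompilerCodeLength
import Literature.Computability.QuantumComplexity.ExactCompilerDescendCorrect
import HarnessLib

/-!
# Word lengths along the braid compiler and the cap that is never reached

Topic `Literature/Computability/QuantumComplexity`, sequel of `CompilerCodeFP.lean` and
`CompilerCodeLength.lean` (Aharonov–Arad 2011, Thm. 3.1, §3.3). We bound the word lengths of all
candidates met by `ExactCompiler.compile` — the tower (`wlen_towerLast_le`: `≤ 4^j (|c₀| + 2v)`),
the powers, the level candidates, the descent (`wlen_descend_le`) — by an explicit quantity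
`wordBound v w₀ S Jmax L`, and conclude that with any cap at least
`capBound mat₀ v w₀ S Jmax L` (linear in `wordBound` through `length_candE_le_of_wf`) the capped
compiler computes the compiler: **`compileCap_eq_compile`**.

## References

* D. Aharonov, I. Arad, New J. Phys. 13 (2011) 035019, §3.3 [AharonovArad2011].
-/

namespace Literature.Computability.QuantumComplexity

open Literature.Computability.Complexity Literature.Computability.Complexity.CodeFP ExactCompiler

/-! ### Word lengths of the elementary operations -/

/-- The total word length of a candidate. [folklore] -/
def wlen (c : Cand Letter) : ℕ := c.word.length + c.iword.length

/-- `wlen one = 0`. [folklore] -/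
@[simp] theorem wlen_one : wlen Cand.one = 0 := rfl

/-- `wlen (a b) = wlen a + wlen b`. [folklore] -/
@[simp] theorem wlen_mul (a b : Cand Letter) : wlen (a.mul b) = wlen a + wlen b := by
  simp [wlen, Cand.mul]; omega

/-- `wlen a⁻¹ = wlen a`. [folklore] -/
@[simp] theorem wlen_inv (a : Cand Letter) : wlen a.inv = wlen a := by simp [wlen, Cand.inv]; omega

/-- `wlen (V c V⁻¹) = 2 wlen V + wlen c`. [folklore] -/
@[simp] theorem wlen_conj (V c : Cand Letter) : wlen (V.conj c) = 2 * wlen V + wlen c := by simp [Cand.conj]; omega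

/-- `wlen [a, b] = 2 (wlen a + wlen b)`. [folklore] -/
@[simp] theorem wlen_gcomm (a b : Cand Letter) : wlen (a.gcomm b) = 2 * (wlen a + wlen b) := by simp [Cand.gcomm]; omega

/-- `wlen (c^n) = n wlen c`. [folklore] -/
@[simp] theorem wlen_pow (c : Cand Letter) : ∀ n, wlen (c.pow n) = n * wlen c
  | 0 => by simp [Cand.pow]
  | n + 1 => by rw [Cand.pow, wlen_mul, wlen_pow c n]; ring

/-- The largest word length in a list. [folklore] -/
def maxWlen (l : List (Cand Letter)) : ℕ := (l.map wlen).foldr max 0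

/-- Members are bounded by `maxWlen`. [folklore] -/
theorem wlen_le_maxWlen {l : List (Cand Letter)} {c : Cand Letter} (h : c ∈ l) : wlen c ≤ maxWlen l := by
  unfold maxWlen
  induction l with
  | nil => cases h
  | cons x l ih =>
    rw [List.map_cons, List.foldr_cons]
    rcases List.mem_cons.1 h with rfl | h
    · exact le_max_left _ _
    · exact (ih h).trans (le_max_right _ _)

/-- `bestBy` does not exceed the larger of the default and the list. [folklore] -/
theorem wlen_bestBy_le (better : ZPhiS → ZPhiS → Bool) (key : Cand Letter → ZPhiS) (d : Cand Letter) (l : List (Cand Letter)) {B : ℕ}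
    (hd : wlen d ≤ B) (hl : ∀ x ∈ l, wlen x ≤ B) : wlen (bestBy better key d l) ≤ B := by
  rcases bestBy_mem better key d l with h | h
  · rw [h]; exact hd
  · exact hl _ h

/-- `headD` does not exceed the larger of the default and the list. [folklore] -/
theorem wlen_headD_le (l : List (Cand Letter)) (d : Cand Letter) {B : ℕ} (hd : wlen d ≤ B) (hl : ∀ x ∈ l, wlen x ≤ B) : wlen (l.headD d) ≤ B := by
  cases l with
  | nil => exact hd
  | cons x t => exact hl x (by simp)

/-! ### The tower -/

/-- **One tower step at most quadruples**: `wlen (towerStep net c) ≤ 4 wlen c + 4 v`. [cite: AharonovArad2011, §3.3] -/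
theorem wlen_towerStep_le (net : List (Cand Letter)) (c : Cand Letter) : wlen (towerStep net c) ≤ 4 * wlen c + 4 * maxWlen net := by
  unfold towerStep
  have hall : ∀ x ∈ net.map (fun V => c.gcomm (V.conj c)), wlen x ≤ 4 * wlen c + 4 * maxWlen net := by
    intro x hx
    obtain ⟨V, hV, rfl⟩ := List.mem_map.1 hx
    have := wlen_le_maxWlen hV
    simp; omega
  exact wlen_bestBy_le _ _ _ _ (wlen_headD_le _ _ (by omega) hall) hall

/-- **The tower grows like `4^j`**: `wlen (towerLast j) + 2v ≤ 4^j (wlen c₀ + 2v)`. [cite: AharonovArad2011, §3.3] -/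
theorem wlen_towerLast_le (net : List (Cand Letter)) (c₀ : Cand Letter) : ∀ j : ℕ,
    wlen (towerLast net c₀ j) + 2 * maxWlen net ≤ 4 ^ j * (wlen c₀ + 2 * maxWlen net)
  | 0 => by rw [towerLast_zero]; simp
  | j + 1 => by
    rw [towerLast_succ, pow_succ]
    have ih := wlen_towerLast_le net c₀ j
    have h := wlen_towerStep_le net (towerLast net c₀ j)
    nlinarith

/-- Members of the tower. [folklore] -/
theorem wlen_le_of_mem_tower {net : List (Cand Letter)} {c₀ : Cand Letter} {S : ℕ} {c : Cand Letter} (hc : c ∈ tower net c₀ S) :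
    wlen c ≤ 4 ^ S * (wlen c₀ + 2 * maxWlen net) := by
  obtain ⟨s, hs, rfl⟩ := (mem_tower_iff net c₀ S c).1 hc
  have h := wlen_towerLast_le net c₀ s
  have hp : 4 ^ s ≤ 4 ^ S := Nat.pow_le_pow_right (by norm_num) hs
  nlinarith

/-- The last element of the tower is a member. [folklore] -/
theorem getLastD_tower_mem (net : List (Cand Letter)) (c₀ d : Cand Letter) (S : ℕ) : (tower net c₀ S).getLastD d ∈ tower net c₀ S := by
  have hne := tower_ne_nil net c₀ S
  rw [List.getLastD_eq_getLast?, List.getLast?_eq_some_getLast hne, Option.getD_some]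
  exact List.getLast_mem hne

/-! ### The descent -/

/-- **The bound on all word lengths** of a run of depth `S`, search bound `Jmax`, `L` levels, net
bound `v`, seed length `w₀`. [cite: AharonovArad2011, §3.3] -/
def wordBound (v w₀ S Jmax L : ℕ) : ℕ := (L + 2) * (2 * v + (Jmax + 1) * (4 ^ S * (w₀ + 2 * v)))

/-- Members of the level candidates. [folklore] -/
theorem wlen_le_of_mem_levelCands {net : List (Cand Letter)} {c : Cand Letter} {J : ℕ} {Y : Cand Letter} (hY : Y ∈ levelCands net c J) :
    wlen Y ≤ 2 * maxWlen net + J * wlen c := by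
  unfold levelCands at hY
  obtain ⟨V, hV, hY⟩ := List.mem_flatMap.1 hY
  obtain ⟨j, hj, hY⟩ := List.mem_flatMap.1 hY
  rw [List.mem_range] at hj
  have hv := wlen_le_maxWlen hV
  simp only [List.mem_cons, List.mem_nil_iff, or_false] at hY
  have hjJ : j * wlen c ≤ J * wlen c := Nat.mul_le_mul_right _ (by omega)
  rcases hY with rfl | rfl <;> simp <;> nlinarith

/-- **One level of the descent adds at most `2v + Jmax · T`** to the word length, `T` a bound on
the tower. [cite: AharonovArad2011, §3.3] -/
theorem wlen_levelStep_le {net towerL : List (Cand Letter)} {T : ℕ} (hT : ∀ c ∈ towerL, wlen c ≤ T) (hne : towerL ≠ [])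
    (score : Matrix (Fin 2) (Fin 2) K5 → ZPhiS) (p q Jmax : ℕ) (W : Cand Letter) :
    wlen (levelStep net towerL score p q Jmax W) ≤ 2 * maxWlen net + Jmax * T + wlen W := by
  rw [levelStep_eq, wlen_mul]
  set c := (towerL.find? (smallTest p (16 * q))).getD (towerL.getLastD Cand.one)
  have hc : wlen c ≤ T := by
    apply hT
    change (towerL.find? (smallTest p (16 * q))).getD (towerL.getLastD Cand.one) ∈ towerL
    cases hf : towerL.find? (smallTest p (16 * q)) with
    | some x => simpa using List.mem_of_find?_eq_some hf
    | none =>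
      simp only [Option.getD_none]
      rw [List.getLastD_eq_getLast?, List.getLast?_eq_some_getLast hne, Option.getD_some]; exact List.getLast_mem hne
  have hJ := findJ_le p q Jmax c
  have hall : ∀ Y ∈ levelCands net c (findJ p q Jmax c), wlen Y ≤ 2 * maxWlen net + Jmax * T := fun Y hY =>
    (wlen_le_of_mem_levelCands hY).trans (by nlinarith [Nat.mul_le_mul hJ hc])
  have h0 : wlen Cand.one ≤ 2 * maxWlen net + Jmax * T := by rw [wlen_one]; exact Nat.zero_le _
  have := wlen_bestBy_le (fun a b => ZPhiS.lt b a) (fun X => score (X.mat * W.mat)) _ _ (wlen_headD_le _ _ h0 hall) hall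
  omega

/-- `initW` is in the net (or trivial). [folklore] -/
theorem wlen_initW_le (net : List (Cand Letter)) (score : Matrix (Fin 2) (Fin 2) K5 → ZPhiS) : wlen (initW net score) ≤ maxWlen net :=
  wlen_bestBy_le _ _ _ _ (wlen_headD_le _ _ (by rw [wlen_one]; exact Nat.zero_le _) fun _ h => wlen_le_maxWlen h) fun _ h => wlen_le_maxWlen h

/-- **The descent's word length grows linearly in the number of levels.** [cite: AharonovArad2011, §3.3] -/
theorem wlen_descend_le {net towerL : List (Cand Letter)} {T : ℕ} (hT : ∀ c ∈ towerL, wlen c ≤ T) (hne : towerL ≠ [])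
    (score : Matrix (Fin 2) (Fin 2) K5 → ZPhiS) (Jmax : ℕ) (sched : List (ℕ × ℕ × ℕ)) (hJ : ∀ s ∈ sched, s.2.2 = Jmax) (W₀ : Cand Letter) :
    wlen (descend net towerL score sched W₀) ≤ wlen W₀ + sched.length * (2 * maxWlen net + Jmax * T) := by
  unfold descend
  induction sched using List.reverseRecOn with
  | nil => simp
  | append_singleton l s ih =>
    rw [List.foldl_append, List.foldl_cons, List.foldl_nil, List.length_append, List.length_singleton]
    have h1 := ih (fun s' hs' => hJ s' (List.mem_append_left _ hs'))
    have h2 := wlen_levelStep_le (net := net) hT hne score s.1 s.2.1 s.2.2 (l.foldl (fun W s => levelStep net towerL score s.1 s.2.1 s.2.2 W) W₀)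
    rw [hJ s (by simp)] at h2 ⊢
    rw [Nat.add_mul, one_mul]
    omega

/-! ### The cap -/

/-- **The cap that is never reached.** [cite: AharonovArad2011, §3.3] -/
def capBound (mat₀ : Letter → Matrix (Fin 2) (Fin 2) K5) (v w₀ S Jmax L : ℕ) : ℕ :=
  (4 * S + 6) * (candA mat₀ * wordBound v w₀ S Jmax L + candB) + 4 * S + 8

variable (E : EvalSpec Letter)

/-- Code bound from a word bound, for well-formed candidates. [folklore] -/
theorem length_candE_le_of_wlen {c : Cand Letter} (hc : c.WF E.mat₀) {B : ℕ} (hB : wlen c ≤ B) :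
    (candE c).length ≤ candA E.mat₀ * B + candB :=
  (length_candE_le_of_wf hc).trans (by unfold wlen at hB; nlinarith)

/-- **With a cap at least `capBound`, the capped compiler computes the compiler.** The net is
well formed with word lengths `≤ v`, the seed well formed of word length `≤ w₀`, the schedule is
`schedule L S` presented as `((1, 200·4^t))_t` with `Jmax` in unary. [cite: AharonovArad2011, §3.3] -/
theorem compileCap_eq_compile {net : List (Cand Letter)} (hnet : AllWF E net) {c₀ : Cand Letter} (hc₀ : c₀.WF E.mat₀)
    {v w₀ : ℕ} (hv : maxWlen net ≤ v) (hw₀ : wlen c₀ ≤ w₀) (sc : Matrix (Fin 2) (Fin 2) K5 → ZPhiS) (S Jmax L : ℕ) {cap : ℕ}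
    (hcap : capBound E.mat₀ v w₀ S Jmax L ≤ cap) :
    compileCap sc cap net c₀ S (List.replicate Jmax ()) ((List.range L).map fun t => (1, 200 * 4 ^ t)) =
      compile net c₀ S sc ((List.range L).map fun t => (1, 200 * 4 ^ t, Jmax)) := by
  -- the global word bound and its code bound
  set WB := wordBound v w₀ S Jmax L with hWB
  have hTw : ∀ j ≤ S, ∀ c ∈ tower net c₀ j, wlen c ≤ 4 ^ S * (w₀ + 2 * v) := by
    intro j hj c hc
    refine (wlen_le_of_mem_tower hc).trans ?_
    have : 4 ^ j ≤ 4 ^ S := Nat.pow_le_pow_right (by norm_num) hj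
    have : wlen c₀ + 2 * maxWlen net ≤ w₀ + 2 * v := by omega
    exact Nat.mul_le_mul ‹4 ^ j ≤ 4 ^ S› this
  set X := 4 ^ S * (w₀ + 2 * v) with hX
  set Y := 2 * v + (Jmax + 1) * X with hY
  have hXY : X ≤ Y := by
    have : X ≤ (Jmax + 1) * X := Nat.le_mul_of_pos_left _ (by omega)
    omega
  have hYWB : WB = (L + 2) * Y := by rw [hWB, wordBound]
  have hYWB' : Y ≤ WB := by rw [hYWB]; exact Nat.le_mul_of_pos_left _ (by omega)
  have hTS : X ≤ WB := hXY.trans hYWB'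
  have hcode : ∀ c : Cand Letter, c.WF E.mat₀ → wlen c ≤ WB → (candE c).length ≤ candA E.mat₀ * WB + candB :=
    fun c hc hB => length_candE_le_of_wlen E hc hB
  have hKcap : candA E.mat₀ * WB + candB ≤ cap := by
    refine le_trans ?_ hcap
    rw [capBound]; nlinarith [Nat.zero_le ((4 * S + 5) * (candA E.mat₀ * WB + candB))]
  have e : (List.replicate Jmax ()).length = Jmax := List.length_replicate
  refine (compileCap_eq (sc := sc) ?_ ?_ ?_ ?_).trans (by rw [List.map_map, e]; rfl)
  · -- `hc₀`: both defaults are irrelevant for a nonempty tower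
    have hne := tower_ne_nil net c₀ S
    rw [List.getLastD_eq_getLast?, List.getLastD_eq_getLast?, List.getLast?_eq_some_getLast hne]; rfl
  · -- the tower pairs
    intro j hj
    rw [pairE_apply, length_boolPair, length_rawE]
    have hall : ∀ c ∈ tower net c₀ j, (candE c).length ≤ candA E.mat₀ * WB + candB := fun c hc =>
      hcode c (allWF_tower E hnet hc₀ j c hc) ((hTw j hj c hc).trans hTS)
    have hlast := hall _ (getLastD_tower_mem net c₀ c₀ j)
    have hlen : (tower net c₀ j).length = j + 1 := by
      clear hall hlast; induction j with
      | zero => rfl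
      | succ j ih => rw [tower, List.length_append, ih (by omega)]; rfl
    have hsum : ((tower net c₀ j).map fun a => 2 * (candE a).length + 2).sum ≤ (j + 1) * (2 * (candA E.mat₀ * WB + candB) + 2) := by
      rw [← hlen]
      have : ∀ l : List (Cand Letter), (∀ c ∈ l, (candE c).length ≤ candA E.mat₀ * WB + candB) →
          (l.map fun a => 2 * (candE a).length + 2).sum ≤ l.length * (2 * (candA E.mat₀ * WB + candB) + 2) := by
        intro l hl
        induction l with
        | nil => simp
        | cons a l ih =>
          rw [List.map_cons, List.sum_cons, List.length_cons]
          have := hl a (by simp); have := ih (fun c hc => hl c (List.mem_cons_of_mem _ hc)); nlinarith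
      exact this _ hall
    refine le_trans ?_ hcap
    rw [capBound]
    have hj' : j + 1 ≤ S + 1 := by omega
    nlinarith [Nat.mul_le_mul_right (2 * (candA E.mat₀ * WB + candB) + 2) hj']
  · -- the powers of tower elements
    intro c hc k hk
    rw [e] at hk
    have hcmem : c ∈ tower net c₀ S := by
      rcases hc with hc | rfl
      · exact hc
      · exact getLastD_tower_mem net c₀ Cand.one S
    have hcwf : c.WF E.mat₀ := allWF_tower E hnet hc₀ S c hcmem
    have hcw : wlen c ≤ 4 ^ S * (w₀ + 2 * v) := hTw S le_rfl c hcmem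
    have hkw : k * wlen c ≤ WB := by
      calc k * wlen c ≤ Jmax * X := Nat.mul_le_mul hk hcw
        _ ≤ (Jmax + 1) * X := Nat.mul_le_mul_right _ (Nat.le_succ _)
        _ ≤ Y := by omega
        _ ≤ WB := hYWB'
    constructor
    · exact (hcode _ (hcwf.pow k) (by rw [wlen_pow]; exact hkw)).trans hKcap
    · exact (hcode _ (hcwf.inv.pow k) (by rw [wlen_pow, wlen_inv]; exact hkw)).trans hKcap
  · -- the descent
    intro l₁ l₂ hl
    have hTall : ∀ c ∈ tower net c₀ S, wlen c ≤ 4 ^ S * (w₀ + 2 * v) := hTw S le_rfl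
    have hwf := wf_descend E hnet (allWF_tower E hnet hc₀ S) sc
    -- `descend` on a mapped prefix of the schedule is well formed and short
    have hl₁ : l₁.length ≤ L := by
      have := congrArg List.length hl; rw [List.length_append, List.length_map, List.length_range] at this; omega
    have hwl := wlen_descend_le (net := net) hTall (tower_ne_nil net c₀ S) sc Jmax (l₁.map fun pq => (pq.1, pq.2, (List.replicate Jmax ()).length))
      (fun s hs => by obtain ⟨pq, _, rfl⟩ := List.mem_map.1 hs; exact e) (initW net sc)
    have hW₀ := wlen_initW_le net sc
    have hbound : wlen (descend net (tower net c₀ S) sc (l₁.map fun pq => (pq.1, pq.2, (List.replicate Jmax ()).length)) (initW net sc)) ≤ WB := by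
      have hwl' : wlen (descend net (tower net c₀ S) sc (l₁.map fun pq => (pq.1, pq.2, (List.replicate Jmax ()).length)) (initW net sc)) ≤
          wlen (initW net sc) + l₁.length * (2 * maxWlen net + Jmax * X) := by
        have := hwl; rwa [List.length_map] at this
      rw [hYWB, Nat.add_mul]
      have hin : 2 * maxWlen net + Jmax * X ≤ Y := by
        have : Jmax * X ≤ (Jmax + 1) * X := Nat.mul_le_mul_right _ (Nat.le_succ _)
        omega
      have h1 : l₁.length * (2 * maxWlen net + Jmax * X) ≤ L * Y := Nat.mul_le_mul hl₁ hin
      have h0 : wlen (initW net sc) ≤ 2 * Y := by omega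
      omega
    -- well-formedness of the prefix descent: it is a `descend` along `range l₁.length` re-indexed
    have hwfD : (descend net (tower net c₀ S) sc (l₁.map fun pq => (pq.1, pq.2, (List.replicate Jmax ()).length)) (initW net sc)).WF E.mat₀ := by
      have key : ∀ (sched : List (ℕ × ℕ × ℕ)) (W₀ : Cand Letter), W₀.WF E.mat₀ → (descend net (tower net c₀ S) sc sched W₀).WF E.mat₀ := by
        intro sched
        induction sched using List.reverseRecOn with
        | nil => intro W₀ h; simpa [descend] using h
        | append_singleton l s ih =>
          intro W₀ h
          rw [descend, List.foldl_append, List.foldl_cons, List.foldl_nil, ← descend]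
          exact wf_levelStep E hnet (allWF_tower E hnet hc₀ S) sc _ _ _ (ih W₀ h)
      exact key _ _ (wf_initW E hnet sc)
    exact (hcode _ hwfD hbound).trans hKcap

end Literature.Computability.QuantumComplexity
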